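import Mathlib

/-!
# STUB-PLAN v1.5 (critic g4) — kernel check of the shape in which the T1⁻-FALLBACK chain consumes
# k2-g3's Plan 1 («torsion-exact control along the line»): from a divisibility
# `G ∣ (X + C (1 - u⁻¹)) · H` in `ℤ_[p]⟦X⟧` one reads at `X = 0` the one-sided value bound
# `‖u - 1‖ · ‖H(0)‖ ≤ ‖G(0)‖`, i.e. `ord_p G(0) ≤ ord_p H(0) + ord_p (u - 1)`.
# Independent re-proof (the ideator's Sketch.lean is attached as item evidence only and is not
# readable from this jail). Generic prime `p`; the plan uses `p = 2`, `u = u_w`.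
-/

set_option linter.dupNamespace false

namespace Summit.BirchSwinnertonDyer.BirchSwinnertonDyer.Theorems.PrintCf2.LowerStubControlValue

open PowerSeries

variable {p : ℕ} [Fact p.Prime]

/-- In `ℤ_[p]`, a divisor has norm at least that of its multiple. -/
theorem norm_le_norm_of_dvd {a b : ℤ_[p]} (h : a ∣ b) : ‖b‖ ≤ ‖a‖ := by
  obtain ⟨c, rfl⟩ := h
  calc ‖a * c‖ = ‖a‖ * ‖c‖ := norm_mul a c
    _ ≤ ‖a‖ * 1 := by gcongr; exact PadicInt.norm_le_one c
    _ = ‖a‖ := mul_one _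

/-- Constant coefficients respect divisibility. -/
theorem constantCoeff_dvd_of_dvd {R : Type*} [CommSemiring R] {G F : PowerSeries R} (h : G ∣ F) :
    constantCoeff G ∣ constantCoeff F :=
  map_dvd constantCoeff h

/-- `‖1 - u⁻¹‖ = ‖u - 1‖` for a unit `u` of `ℤ_[p]`. -/
theorem norm_one_sub_inv_eq (u : ℤ_[p]ˣ) :
    ‖(1 : ℤ_[p]) - ↑u⁻¹‖ = ‖(u : ℤ_[p]) - 1‖ := by
  have h : (u : ℤ_[p]) * ((1 : ℤ_[p]) - ↑u⁻¹) = (u : ℤ_[p]) - 1 := by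
    rw [mul_sub, mul_one, Units.mul_inv]
  have hu : ‖(u : ℤ_[p])‖ = 1 := PadicInt.isUnit_iff.mp (Units.isUnit u)
  calc ‖(1 : ℤ_[p]) - ↑u⁻¹‖ = ‖(u : ℤ_[p])‖ * ‖(1 : ℤ_[p]) - ↑u⁻¹‖ := by rw [hu, one_mul]
    _ = ‖(u : ℤ_[p]) * ((1 : ℤ_[p]) - ↑u⁻¹)‖ := (norm_mul _ _).symm
    _ = ‖(u : ℤ_[p]) - 1‖ := by rw [h]

/-- The constant coefficient of `(X + C a) · H` is `a · H(0)`. -/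
theorem constantCoeff_X_add_C_mul (a : ℤ_[p]) (H : PowerSeries ℤ_[p]) :
    constantCoeff ((X + C a) * H) = a * constantCoeff H := by
  simp [map_mul, map_add]

/-- **The consumed shape of k2-g3 Plan 1** (torsion-exact control, read at the trivial character):
`G ∣ (X + C (1 - u⁻¹)) · H` ⟹ `‖u - 1‖ · ‖H(0)‖ ≤ ‖G(0)‖`. -/
theorem lower_value_bound_of_dvd_control (u : ℤ_[p]ˣ) {G H : PowerSeries ℤ_[p]}
    (h : G ∣ (X + C ((1 : ℤ_[p]) - ↑u⁻¹)) * H) :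
    ‖(u : ℤ_[p]) - 1‖ * ‖constantCoeff H‖ ≤ ‖constantCoeff G‖ := by
  have h1 : constantCoeff G ∣ ((1 : ℤ_[p]) - ↑u⁻¹) * constantCoeff H := by
    rw [← constantCoeff_X_add_C_mul]
    exact constantCoeff_dvd_of_dvd h
  have h2 := norm_le_norm_of_dvd h1
  rwa [norm_mul, norm_one_sub_inv_eq] at h2

/-- The same with an extra correction factor `c` (e.g. the `char(X₂[J])` / pseudo-null bookkeeping):
`G ∣ c · (X + C (1 - u⁻¹)) · H` ⟹ `‖c‖ · ‖u - 1‖ · ‖H(0)‖ ≤ ‖G(0)‖`. -/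
theorem lower_value_bound_of_dvd_control' (u : ℤ_[p]ˣ) (c : ℤ_[p]) {G H : PowerSeries ℤ_[p]}
    (h : G ∣ C c * ((X + C ((1 : ℤ_[p]) - ↑u⁻¹)) * H)) :
    ‖c‖ * ‖(u : ℤ_[p]) - 1‖ * ‖constantCoeff H‖ ≤ ‖constantCoeff G‖ := by
  have h1 : constantCoeff G ∣ c * (((1 : ℤ_[p]) - ↑u⁻¹) * constantCoeff H) := by
    have := constantCoeff_dvd_of_dvd h
    simpa [map_mul, map_add] using this
  have h2 := norm_le_norm_of_dvd h1
  rw [norm_mul, norm_mul, norm_one_sub_inv_eq, ← mul_assoc] at h2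
  exact h2

/-- Sanity instance of the direction: with `G = (X + C (1 - u⁻¹)) · H` itself the hypothesis holds,
so the bound is attained-shape (no hidden sign error in the direction LOWER consumes). -/
example (u : ℤ_[p]ˣ) (H : PowerSeries ℤ_[p]) :
    ‖(u : ℤ_[p]) - 1‖ * ‖constantCoeff H‖ ≤ ‖constantCoeff ((X + C ((1 : ℤ_[p]) - ↑u⁻¹)) * H)‖ :=
  lower_value_bound_of_dvd_control u (dvd_refl _)

end Summit.BirchSwinnertonDyer.BirchSwinnertonDyer.Theorems.PrintCf2.LowerStubControlValue
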